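import Mathlib

/-!
# The two «one-line» inferences of N3 row T4 (multiplicity one from a trace identity; an average of
characters is 0 or 1) — kernel witnesses

Blind cell `pub-hodge-repro2`, seat p4, Tier-5 support. README §8(d): this file uses an
L-value-free non-vanishing device: NO (kernel checks of standard inferences already written out on
the cell's record).

`route/T5-N3-route-2.md` §N3.7(a) [G-N3-3] (owner route-2) records that the multiplicity-one
statement `m(σ) ≤ 1` used in row T4 rests, beyond the printed text of Rogawski 1990, on two
elementary inferences, each labelled [A] and «one line»:

1. for the stable packets, «the left-hand side of (14.6.2) is equal to `Tr(Π′(f′))`» gives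
   `∑_π m(π) Tr π(f) = Tr Π′(f)` with `Π′` one of the `π`, and one concludes `m(Π′) = 1`,
   `m(π) = 0` otherwise, «by the linear independence of characters»;
2. for the endoscopic packets the printed formula `m(π′) = |Π̂′|⁻¹ ∑_s ⟨s, π⟩` needs
   «an average of characters of a finite abelian group is 0 or 1».

We kernel-check exactly these two inferences in their abstract form:

* `coeff_eq_of_linearIndependent` — if a family `χ : ι → M` is linearly independent and
  `∑_{i ∈ s} (m i) • χ i = χ i₀` with `i₀ ∈ s`, then `m i₀ = 1` and `m i = 0` for `i ≠ i₀` in `s`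
  (the coefficients are read off by `linearIndependent_iff'`); the natural-number version
  `natCoeff_eq_of_linearIndependent` for multiplicities `m : ι → ℕ`; and the corollary
  `multiplicity_le_one_of_linearIndependent`: every multiplicity is `≤ 1`.
* `average_addChar_eq_zero_or_one` — for a finite abelian group `S` and a character
  `ψ : AddChar S ℂ`, `|S|⁻¹ ∑_s ψ s ∈ {0, 1}` (it is `1` iff `ψ` is trivial,
  `average_addChar_eq_ite`; from Mathlib's `AddChar.sum_eq_ite`).

The linear independence of the characters of inequivalent irreducible representations of a
reductive group (the input to inference 1, a theorem of Harish-Chandra quoted by Rogawski) is NOT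
proved here — it is the hypothesis `LinearIndependent ℂ χ` of the statements; for the characters of
a finite group Mathlib's `linearIndependent_monoidHom` (Dedekind) is an instance of it.

Mathlib only; no sorry; axioms ⊆ {propext, Classical.choice, Quot.sound}.
-/

namespace Summit.Ventures.HodgeRepro2.T5MultiplicityInferences

section LinearIndependent

variable {ι : Type*} {M : Type*} [AddCommGroup M] [Module ℂ M] {χ : ι → M}

/-- Inference 1, scalar form: a linear relation `∑_{i ∈ s} (m i) • χ i = χ i₀` between linearly
independent vectors forces `m i₀ = 1` and `m i = 0` for the other `i ∈ s`. -/
theorem coeff_eq_of_linearIndependent [DecidableEq ι] (hχ : LinearIndependent ℂ χ) {s : Finset ι}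
    {i₀ : ι} (hi₀ : i₀ ∈ s) {m : ι → ℂ} (hm : ∑ i ∈ s, m i • χ i = χ i₀) :
    m i₀ = 1 ∧ ∀ i ∈ s, i ≠ i₀ → m i = 0 := by
  have hrel : ∑ i ∈ s, (m i - if i = i₀ then 1 else 0) • χ i = 0 := by
    simp_rw [sub_smul, Finset.sum_sub_distrib, hm, ite_smul, one_smul, zero_smul,
      Finset.sum_ite_eq' s i₀, if_pos hi₀, sub_self]
  have h := linearIndependent_iff'.mp hχ s _ hrel
  refine ⟨?_, fun i hi hne => ?_⟩
  · have := h i₀ hi₀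
    simpa [sub_eq_zero] using this
  · have := h i hi
    simpa [hne] using this

/-- Inference 1, multiplicity form (`m : ι → ℕ`): `∑_{i ∈ s} m i • χ i = χ i₀` with `χ` linearly
independent forces `m i₀ = 1` and `m i = 0` for `i ≠ i₀` in `s`. -/
theorem natCoeff_eq_of_linearIndependent [DecidableEq ι] (hχ : LinearIndependent ℂ χ)
    {s : Finset ι} {i₀ : ι} (hi₀ : i₀ ∈ s) {m : ι → ℕ} (hm : ∑ i ∈ s, m i • χ i = χ i₀) :
    m i₀ = 1 ∧ ∀ i ∈ s, i ≠ i₀ → m i = 0 := by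
  have hm' : ∑ i ∈ s, ((m i : ℕ) : ℂ) • χ i = χ i₀ := by
    simpa only [Nat.cast_smul_eq_nsmul] using hm
  obtain ⟨h1, h2⟩ := coeff_eq_of_linearIndependent hχ hi₀ hm'
  exact ⟨by exact_mod_cast h1, fun i hi hne => by exact_mod_cast h2 i hi hne⟩

/-- Consequently every multiplicity in such a relation is at most one: `m(σ) ≤ 1`. -/
theorem multiplicity_le_one_of_linearIndependent [DecidableEq ι] (hχ : LinearIndependent ℂ χ)
    {s : Finset ι} {i₀ : ι} (hi₀ : i₀ ∈ s) {m : ι → ℕ} (hm : ∑ i ∈ s, m i • χ i = χ i₀)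
    (i : ι) (hi : i ∈ s) : m i ≤ 1 := by
  obtain ⟨h1, h2⟩ := natCoeff_eq_of_linearIndependent hχ hi₀ hm
  by_cases hne : i = i₀
  · rw [hne, h1]
  · rw [h2 i hi hne]
    exact Nat.zero_le 1

end LinearIndependent

section Average

variable {S : Type*} [AddCommGroup S] [Fintype S]

/-- Inference 2: the average of a character of a finite abelian group is `1` for the trivial
character and `0` otherwise (Mathlib's `AddChar.sum_eq_ite`). -/
theorem average_addChar_eq_ite (ψ : AddChar S ℂ) [Decidable (ψ = 0)] :
    (Fintype.card S : ℂ)⁻¹ * ∑ s : S, ψ s = if ψ = 0 then 1 else 0 := by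
  rw [AddChar.sum_eq_ite]
  split_ifs with h
  · exact inv_mul_cancel₀ (Nat.cast_ne_zero.mpr Fintype.card_ne_zero)
  · exact mul_zero _

/-- Inference 2 as used: «an average of characters of a finite abelian group is 0 or 1». -/
theorem average_addChar_eq_zero_or_one (ψ : AddChar S ℂ) :
    (Fintype.card S : ℂ)⁻¹ * ∑ s : S, ψ s = 0 ∨ (Fintype.card S : ℂ)⁻¹ * ∑ s : S, ψ s = 1 := by
  classical
  rw [average_addChar_eq_ite]
  split_ifs
  · exact Or.inr rfl
  · exact Or.inl rfl

/-- The average is a natural number `≤ 1` — the form in which the printed multiplicity formula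
`m(π′) = |Π̂′|⁻¹ ∑_s ⟨s, π⟩` yields `m(π′) ∈ {0, 1}`. -/
theorem exists_nat_le_one_eq_average (ψ : AddChar S ℂ) :
    ∃ n : ℕ, n ≤ 1 ∧ (Fintype.card S : ℂ)⁻¹ * ∑ s : S, ψ s = n := by
  rcases average_addChar_eq_zero_or_one ψ with h | h
  · exact ⟨0, Nat.zero_le 1, by rw [h, Nat.cast_zero]⟩
  · exact ⟨1, le_refl _, by rw [h, Nat.cast_one]⟩

end Average

end Summit.Ventures.HodgeRepro2.T5MultiplicityInferences
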